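import Summits.ResolutionOfSingularities.ResolutionOfSingularities.Theorems.LossPolygon
import Summits.ResolutionOfSingularities.ResolutionOfSingularities.Theorems.LossIsFatalLayer
import HarnessLib

/-!
# LossPolygon4 — translated wall-chart moves = untranslated moves of the SHEARED equation; exact prepared-frame `Ψ`-laws

decomp-res-lens-3, gen 27, slice 4 of `g27/LossPolygon.lean` (§7; needs only slice 1 `Theorems.LossPolygon` (§1–§3) and the landed
`Theorems.LossIsFatalLayer` (`chartMap`)).  Critic rows 220e/220g: (P3′) «kept exits exact in the directrix-prepared frame» = tool 0.

`shear c a g : u_c ↦ u_c + g·u_a`; `translate_single_chartMap` (chart `a` then translate along `c` = shear then chart `a`);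
`st_succ_F_shear` (`F_{t+1} = deletePthPowers q (chartTransform q a (σ F_t))` at a move in chart `a` translated only along `c`);
`support_succ_shear`; `polyPts_succ_chart_fst_translated` / `polyPts_succ_chart_snd_translated` (EXACT `Ψ₍₁:₀₎` / `Ψ₍₀:₁₎` laws on
the point set of the sheared-and-cleaned equation).  X2-type moves (chart of the free letter, translated along a wall) are not
covered (they change the multiplicity frame).
-/

open MvPolynomial Finset
open Literature.AlgebraicGeometry.Resolution
open Literature.AlgebraicGeometry.Resolution.Hauser2010
open Literature.AlgebraicGeometry.Resolution.PointBlowup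
open Summit.ResolutionOfSingularities.ResolutionOfSingularities.Theorems.TightDefectClasses
open Summit.ResolutionOfSingularities.ResolutionOfSingularities.Theorems.TightDefectStrongWalks
open Summit.ResolutionOfSingularities.ResolutionOfSingularities.Theorems.ItineraryCutClasses
open Summit.ResolutionOfSingularities.ResolutionOfSingularities.Theorems.BoundaryLedger
open Summit.ResolutionOfSingularities.ResolutionOfSingularities.Theorems.ProximityCut
open Summit.ResolutionOfSingularities.ResolutionOfSingularities.Theorems.LossExitCone
open Summit.ResolutionOfSingularities.ResolutionOfSingularities.Theorems.LossIsFatalLayer (chartMap chartMap_X chartMap_X_self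
  chartMap_X_ne chartMap_C)

namespace Summit.ResolutionOfSingularities.ResolutionOfSingularities.Theorems.LossPolygon

variable {K : Type} [Field K] [DecidableEq K]
variable {q : ℕ} {s₀ : State (Fin 3) K}

/-! ## §7 Translated moves in the chart of a WALL letter = untranslated moves of the SHEARED equation (prepared frame)

CJS's «prepared coordinates» in kernel form: translating `u_c ↦ u_c + g` AFTER the chart `u_a` is the chart `u_a` AFTER the
linear SHEAR `σ_{c,a,g} : u_c ↦ u_c + g·u_a` upstairs (`translate_single_chartMap`).  Hence a move in the chart of a wall letter
`a` translated only along the free letter `c` — a TRANSLATED KEPT EXIT of type X1 when `a` is the loss wall, a TRANSLATED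
R-LETTER / REPEAT when `a` is the run wall — transforms the equation exactly like an UNTRANSLATED `u_a`-move applied to the
sheared equation (`st_succ_F_shear`); the shear can create `q`-th power monomials, which the cleaning then deletes («hidden
kangaroo»), so the point set obeys the EXACT law `Δ_{t+1} = Ψ(Δ(deletePthPowers (σ F_t)))`
(`polyPts_succ_chart_fst_translated` / `polyPts_succ_chart_snd_translated`): (P3′) of SEED-g28 §1 (B″) for wall-chart moves.
Moves in the chart of the FREE letter translated along a wall (type X2) change the multiplicity frame and are NOT covered here.
-/

section Shear

/-- The SHEAR `σ_{c,a,g} : u_c ↦ u_c + g·u_a`, every other variable fixed (a `K`-algebra endomorphism).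
DEFINITION (support; new object). -/
noncomputable def shear (c a : Fin 3) (g : K) : MvPolynomial (Fin 3) K →ₐ[K] MvPolynomial (Fin 3) K :=
  aeval fun w => if w = c then X c + C g * X a else X w

omit [DecidableEq K] in
/-- `shear_X`: definitional unfolding rule of the shear substitution, VERBATIM from the lens file (docstring added by the writer for the gate's docstring lint); the statement is its type. [new; elementary] [folklore] -/
theorem shear_X (c a : Fin 3) (g : K) (w : Fin 3) :
    shear c a g (X w) = if w = c then X c + C g * X a else X w := by
  unfold shear; rw [aeval_X]

omit [DecidableEq K] in
/-- **CHART THEN TRANSLATE = SHEAR THEN CHART (PROVED):** `translate_{g e_c} ∘ φ_a = φ_a ∘ σ_{c,a,g}` (`c ≠ a`).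
[folklore; CJS2020 §12 «prepared coordinates», in our model] -/
theorem translate_single_chartMap {c a : Fin 3} (hca : c ≠ a) (g : K) (F : MvPolynomial (Fin 3) K) :
    PointBlowup.translate (Pi.single c g) (chartMap a F) = chartMap a (shear c a g F) := by
  have key : (aeval fun i => (X i + C ((Pi.single c g : Fin 3 → K) i) : MvPolynomial (Fin 3) K)).comp
      (chartMap a) = (chartMap (K := K) a).comp (shear c a g) := by
    refine MvPolynomial.algHom_ext fun w => ?_
    rw [AlgHom.comp_apply, AlgHom.comp_apply, chartMap_X, shear_X]
    by_cases hwa : w = a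
    · subst hwa
      rw [if_pos rfl, if_neg (Ne.symm hca), chartMap_X_self, aeval_X, Pi.single_eq_of_ne (Ne.symm hca),
        C_0, add_zero]
    · rw [if_neg hwa]
      by_cases hwc : w = c
      · subst hwc
        rw [if_pos rfl, map_mul, aeval_X, aeval_X, Pi.single_eq_same, Pi.single_eq_of_ne (Ne.symm hca), map_add, map_mul,
          chartMap_C, chartMap_X_self, chartMap_X_ne hca, C_0, add_zero]
        ring
      · rw [if_neg hwc, map_mul, aeval_X, aeval_X, Pi.single_eq_of_ne (Ne.symm hca), Pi.single_eq_of_ne hwc,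
          chartMap_X_ne hwa, C_0, add_zero, add_zero]
  have h := AlgHom.congr_fun key F
  rw [AlgHom.comp_apply, AlgHom.comp_apply] at h
  exact h

omit [DecidableEq K] in
/-- The shear of a monomial is homogeneous of the same degree. [folklore] -/
theorem isHomogeneous_shear_monomial (c a : Fin 3) (g : K) (D : Fin 3 →₀ ℕ) (r : K) :
    (shear c a g (monomial D r)).IsHomogeneous D.degree := by
  unfold shear
  rw [aeval_monomial, algebraMap_eq, Finsupp.prod]
  have hdeg : D.degree = 0 + ∑ i ∈ D.support, 1 * D i := by
    rw [zero_add]; simp only [one_mul]; rfl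
  rw [hdeg]
  refine (isHomogeneous_C _ _).mul (IsHomogeneous.prod _ _ _ fun i _ => ?_)
  have h1 : IsHomogeneous (if i = c then X c + C g * X a else X i : MvPolynomial (Fin 3) K) 1 := by
    split_ifs
    · exact (isHomogeneous_X _ _).add ((isHomogeneous_C _ _).mul (isHomogeneous_X _ _))
    · exact isHomogeneous_X _ _
  exact h1.pow (D i)

omit [DecidableEq K] in
/-- **THE SHEAR PRESERVES DEGREES (PROVED):** every monomial of `σ F` has the degree of some monomial of `F`. [folklore] -/
theorem exists_degree_eq_of_mem_support_shear (c a : Fin 3) (g : K) (F : MvPolynomial (Fin 3) K) {E : Fin 3 →₀ ℕ}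
    (hE : E ∈ (shear c a g F).support) : ∃ D ∈ F.support, E.degree = D.degree := by
  classical
  have hsum : shear c a g F = ∑ D ∈ F.support, shear c a g (monomial D (coeff D F)) := by
    conv_lhs => rw [F.as_sum]
    rw [map_sum]
  rw [mem_support_iff, hsum, coeff_sum] at hE
  obtain ⟨D, hD, hne⟩ := Finset.exists_ne_zero_of_sum_ne_zero hE
  refine ⟨D, hD, ?_⟩
  by_contra hdeg
  exact hne ((isHomogeneous_shear_monomial c a g D (coeff D F)).coeff_eq_zero hdeg)

omit [DecidableEq K] in
/-- The shear does not lower the order at the origin. [folklore] -/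
theorem le_ordZero_shear (c a : Fin 3) (g : K) {F : MvPolynomial (Fin 3) K} {n : ℕ} (hF : (n : ℕ∞) ≤ ordZero F) :
    (n : ℕ∞) ≤ ordZero (shear c a g F) := by
  rw [natCast_le_ordZero_iff_forall_coeff] at hF ⊢
  intro E hE
  by_contra hne
  obtain ⟨D, hD, hdeg⟩ := exists_degree_eq_of_mem_support_shear c a g F (mem_support_iff.mpr hne)
  exact (mem_support_iff.mp hD) (hF D (by rw [← hdeg]; exact hE))

/-- A `q`-th power exponent stays a `q`-th power exponent under the chart map. [folklore] -/
theorem isPthPowerExponent_chartExponent {j : Fin 3} {d : Fin 3 →₀ ℕ} (h : IsPthPowerExponent q d) :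
    IsPthPowerExponent q (chartExponent q j d) := by
  classical
  rw [isPthPowerExponent_iff] at h ⊢
  intro i
  rw [chartExponent_apply]
  split_ifs
  · have hsum : q ∣ d.degree := by
      show q ∣ ∑ i ∈ d.support, d i
      exact Finset.dvd_sum fun i _ => h i
    exact Nat.dvd_sub hsum (dvd_refl q)
  · exact h i

omit [DecidableEq K] in
/-- The support of a cleaned polynomial. [folklore] -/
theorem support_deletePthPowers' (H : MvPolynomial (Fin 3) K) :
    (deletePthPowers q H).support = H.support.filter fun E => ¬ IsPthPowerExponent q E := by
  classical
  ext E
  rw [Finset.mem_filter, mem_support_iff, mem_support_iff, coeff_deletePthPowers]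
  constructor
  · intro h
    by_cases hP : IsPthPowerExponent q E
    · rw [if_pos hP] at h; exact absurd rfl h
    · rw [if_neg hP] at h; exact ⟨h, hP⟩
  · rintro ⟨h, hP⟩
    rw [if_neg hP]; exact h

omit [DecidableEq K] in
/-- **SUPPORT OF «CHART, THEN CLEAN» (PROVED, abstract):** for an equation all of whose monomials have degree `≥ q`,
`supp (deletePthPowers q (chartTransform q a H))` is the chart image of the non-`q`-th-power part of `supp H`. [folklore] -/
theorem support_deletePthPowers_chartTransform (a : Fin 3) (H : MvPolynomial (Fin 3) K)
    (hH : ∀ E ∈ H.support, q ≤ E.degree) :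
    (deletePthPowers q (chartTransform q a H)).support =
      (H.support.filter fun E => ¬ IsPthPowerExponent q E).image (chartExponent q a) := by
  classical
  ext D
  rw [Finset.mem_image, mem_support_iff, coeff_deletePthPowers]
  constructor
  · intro h
    have hP : ¬ IsPthPowerExponent q D := fun hP => h (by rw [if_pos hP])
    rw [if_neg hP] at h
    unfold chartTransform at h
    rw [coeff_sum] at h
    obtain ⟨E, hE, hne⟩ := Finset.exists_ne_zero_of_sum_ne_zero h
    have hED : chartExponent q a E = D := by
      by_contra hne'
      rw [coeff_monomial, if_neg hne'] at hne
      exact hne rfl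
    refine ⟨E, Finset.mem_filter.mpr ⟨hE, fun hPE => hP ?_⟩, hED⟩
    rw [← hED]
    exact isPthPowerExponent_chartExponent hPE
  · rintro ⟨E, hE, rfl⟩
    obtain ⟨hE, hPE⟩ := Finset.mem_filter.mp hE
    have hP : ¬ IsPthPowerExponent q (chartExponent q a E) := fun hP =>
      hPE (isPthPowerExponent_of_chartExponent (hH E hE) hP)
    rw [if_neg hP, coeff_chartTransform_chartExponent _ hH hE]
    exact mem_support_iff.mp hE

/-- **THE TRANSLATED STEP IS AN UNTRANSLATED STEP OF THE SHEARED EQUATION (PROVED).**  A move in the chart `a` whose point is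
translated only along `c ≠ a` (`b_t = g e_c`): `F_{t+1} = deletePthPowers q (chartTransform q a (σ_{c,a,g} F_t))`.
[new; CJS2020 §12 «prepared coordinates» + Hauser2010 §F cleaning] -/
theorem st_succ_F_shear (hs : IsRoot q s₀) (W : ForcedWalk q s₀) (t : ℕ) {a c : Fin 3} (hca : c ≠ a) (hj : W.j t = a)
    (hb : ∀ w, w ≠ c → W.b t w = 0) :
    (W.st (t + 1)).F = deletePthPowers q (chartTransform q a (shear c a (W.b t c) (W.st t).F)) := by
  classical
  obtain ⟨o, ho, hqo⟩ := walk_nat hs W t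
  have hord : ((q : ℕ) : ℕ∞) ≤ ordZero (W.st t).F := by rw [ho]; exact_mod_cast hqo
  have hordS : ((q : ℕ) : ℕ∞) ≤ ordZero (shear c a (W.b t c) (W.st t).F) := le_ordZero_shear c a _ hord
  have hbt : W.b t = Pi.single c (W.b t c) := by
    funext w
    by_cases hw : w = c
    · subst hw; rw [Pi.single_eq_same]
    · rw [Pi.single_eq_of_ne hw, hb w hw]
  have hba : W.b t a = 0 := by rw [← hj]; exact W.onExc t
  have hstep : (W.st (t + 1)).F =
      deletePthPowers q (PointBlowup.translate (W.b t) (chartTransform q (W.j t) (W.st t).F)) := by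
    rw [W.st_succ]; rfl
  have h1 : X a ^ q * PointBlowup.translate (W.b t) (chartTransform q a (W.st t).F) =
      X a ^ q * chartTransform q a (shear c a (W.b t c) (W.st t).F) := by
    have h2 : chartMap a (W.st t).F = X a ^ q * chartTransform q a (W.st t).F :=
      (X_pow_mul_chartTransform a hord).symm
    have h3 : chartMap a (shear c a (W.b t c) (W.st t).F) =
        X a ^ q * chartTransform q a (shear c a (W.b t c) (W.st t).F) := (X_pow_mul_chartTransform a hordS).symm
    rw [← h3, ← translate_single_chartMap hca, ← hbt, h2]
    unfold PointBlowup.translate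
    rw [map_mul, map_pow, aeval_X, hba, C_0, add_zero]
  have hX : (X a ^ q : MvPolynomial (Fin 3) K) ≠ 0 := pow_ne_zero _ (X_ne_zero a)
  rw [hstep, hj, mul_left_cancel₀ hX h1]

/-- Coefficient transport at a translated wall-chart move: the coefficient of the image exponent is the coefficient of the
SHEARED equation. [new] -/
theorem coeff_succ_shear (hs : IsRoot q s₀) (W : ForcedWalk q s₀) (t : ℕ) {a c : Fin 3} (hca : c ≠ a) (hj : W.j t = a)
    (hb : ∀ w, w ≠ c → W.b t w = 0) {E : Fin 3 →₀ ℕ} (hE : E ∈ (shear c a (W.b t c) (W.st t).F).support)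
    (hPE : ¬ IsPthPowerExponent q E) :
    coeff (chartExponent q a E) (W.st (t + 1)).F = coeff E (shear c a (W.b t c) (W.st t).F) := by
  classical
  have hH : ∀ E ∈ (shear c a (W.b t c) (W.st t).F).support, q ≤ E.degree := fun E hE => by
    obtain ⟨D, hD, hdeg⟩ := exists_degree_eq_of_mem_support_shear c a _ _ hE
    rw [hdeg]; exact le_degree_of_mem_support hs W t hD
  have hP : ¬ IsPthPowerExponent q (chartExponent q a E) := fun hP =>
    hPE (isPthPowerExponent_of_chartExponent (hH E hE) hP)
  rw [st_succ_F_shear hs W t hca hj hb, coeff_deletePthPowers, if_neg hP, coeff_chartTransform_chartExponent _ hH hE]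

/-- **SUPPORT AT A TRANSLATED WALL-CHART MOVE (PROVED):** the chart image of the cleaned support of the sheared equation. [new] -/
theorem support_succ_shear (hs : IsRoot q s₀) (W : ForcedWalk q s₀) (t : ℕ) {a c : Fin 3} (hca : c ≠ a) (hj : W.j t = a)
    (hb : ∀ w, w ≠ c → W.b t w = 0) :
    (W.st (t + 1)).F.support =
      ((shear c a (W.b t c) (W.st t).F).support.filter fun E => ¬ IsPthPowerExponent q E).image (chartExponent q a) := by
  have hH : ∀ E ∈ (shear c a (W.b t c) (W.st t).F).support, q ≤ E.degree := fun E hE => by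
    obtain ⟨D, hD, hdeg⟩ := exists_degree_eq_of_mem_support_shear c a _ _ hE
    rw [hdeg]; exact le_degree_of_mem_support hs W t hD
  rw [st_succ_F_shear hs W t hca hj hb, support_deletePthPowers_chartTransform a _ hH]

/-- **`Ψ₍₁:₀₎`-LAW AT A TRANSLATED MOVE IN THE CHART OF THE FIRST FRAME LETTER (PROVED)** — e.g. a translated kept exit X1
(`a` = loss wall, translation along the free letter `c`): the new point set is EXACTLY `Ψ₍₁:₀₎` of the point set of the
sheared-and-cleaned («prepared») equation `deletePthPowers q (σ_{c,a,g} F_t)` in the same frame.  (P3′) of SEED-g28 §1 (B″).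
[CJS2020 Lemma 12.1 in prepared coordinates, for the walk; new] -/
theorem polyPts_succ_chart_fst_translated (hs : IsRoot q s₀) (W : ForcedWalk q s₀) (t : ℕ) {a b c : Fin 3} (hab : a ≠ b)
    (hac : a ≠ c) (hbc : b ≠ c) (hj : W.j t = a) (hb : ∀ w, w ≠ c → W.b t w = 0) {s : ℕ}
    (hrb : (W.st (t + 1)).r b = (W.st t).r b) (hra : (W.st (t + 1)).r a + q = s + (W.st t).r a + (W.st t).r b)
    (hrc : (W.st t).r c = 0) (hrc' : (W.st (t + 1)).r c = 0) :
    polyPts s (W.st (t + 1)).r a b c (W.st (t + 1)).F =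
      (polyPts s (W.st t).r a b c (deletePthPowers q (shear c a (W.b t c) (W.st t).F))).image psi10 := by
  classical
  have hH : ∀ E ∈ (shear c a (W.b t c) (W.st t).F).support, q ≤ E.degree := fun E hE => by
    obtain ⟨D, hD, hdeg⟩ := exists_degree_eq_of_mem_support_shear c a _ _ hE
    rw [hdeg]; exact le_degree_of_mem_support hs W t hD
  unfold polyPts
  rw [support_succ_shear hs W t hac.symm hj hb, support_deletePthPowers', Finset.filter_image, Finset.image_image,
    Finset.image_image]
  set Hs := (shear c a (W.b t c) (W.st t).F).support.filter fun E => ¬ IsPthPowerExponent q E with hHs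
  have hfilt : (Hs.filter fun D => chartExponent q a D c < s + (W.st (t + 1)).r c) =
      (Hs.filter fun D => D c < s + (W.st t).r c) := by
    refine Finset.filter_congr fun D _ => ?_
    rw [chartExponent_apply, if_neg hac.symm, hrc, hrc']
  rw [hfilt]
  refine Finset.image_congr fun D hD => ?_
  have hD := Finset.mem_filter.mp hD
  show resPoint s (W.st (t + 1)).r a b c (chartExponent q a D) = psi10 (resPoint s (W.st t).r a b c D)
  have hDc : D c < s := by have h2 := hD.2; rw [hrc, add_zero] at h2; exact h2
  exact resPoint_chartExponent_fst hab hac hbc hrb hra hrc hrc' (hH D (Finset.mem_filter.mp hD.1).1) hDc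

/-- **`Ψ₍₀:₁₎`-LAW AT A TRANSLATED MOVE IN THE CHART OF THE SECOND FRAME LETTER (PROVED)** — e.g. a translated R-letter or
repeat (`b` = run wall, translation along the free letter `c`): EXACTLY `Ψ₍₀:₁₎` of the prepared point set. [CJS2020 Lemma 12.2
in prepared coordinates, for the walk; new] -/
theorem polyPts_succ_chart_snd_translated (hs : IsRoot q s₀) (W : ForcedWalk q s₀) (t : ℕ) {a b c : Fin 3} (hab : a ≠ b)
    (hac : a ≠ c) (hbc : b ≠ c) (hj : W.j t = b) (hb : ∀ w, w ≠ c → W.b t w = 0) {s : ℕ}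
    (hra : (W.st (t + 1)).r a = (W.st t).r a) (hrb : (W.st (t + 1)).r b + q = s + (W.st t).r a + (W.st t).r b)
    (hrc : (W.st t).r c = 0) (hrc' : (W.st (t + 1)).r c = 0) :
    polyPts s (W.st (t + 1)).r a b c (W.st (t + 1)).F =
      (polyPts s (W.st t).r a b c (deletePthPowers q (shear c b (W.b t c) (W.st t).F))).image psi01 := by
  classical
  have hH : ∀ E ∈ (shear c b (W.b t c) (W.st t).F).support, q ≤ E.degree := fun E hE => by
    obtain ⟨D, hD, hdeg⟩ := exists_degree_eq_of_mem_support_shear c b _ _ hE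
    rw [hdeg]; exact le_degree_of_mem_support hs W t hD
  unfold polyPts
  rw [support_succ_shear hs W t hbc.symm hj hb, support_deletePthPowers', Finset.filter_image, Finset.image_image,
    Finset.image_image]
  set Hs := (shear c b (W.b t c) (W.st t).F).support.filter fun E => ¬ IsPthPowerExponent q E with hHs
  have hfilt : (Hs.filter fun D => chartExponent q b D c < s + (W.st (t + 1)).r c) =
      (Hs.filter fun D => D c < s + (W.st t).r c) := by
    refine Finset.filter_congr fun D _ => ?_
    rw [chartExponent_apply, if_neg hbc.symm, hrc, hrc']
  rw [hfilt]
  refine Finset.image_congr fun D hD => ?_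
  have hD := Finset.mem_filter.mp hD
  show resPoint s (W.st (t + 1)).r a b c (chartExponent q b D) = psi01 (resPoint s (W.st t).r a b c D)
  have hDc : D c < s := by have h2 := hD.2; rw [hrc, add_zero] at h2; exact h2
  exact resPoint_chartExponent_snd hab hac hbc hra hrb hrc hrc' (hH D (Finset.mem_filter.mp hD.1).1) hDc

end Shear

end Summit.ResolutionOfSingularities.ResolutionOfSingularities.Theorems.LossPolygon
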